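import Summits.BirchSwinnertonDyer.BirchSwinnertonDyer.Theorems.KatoDescentPotSupersingularFineSelmerControl
import HarnessLib

/-!
# The fine control theorem with the FINE MORDELL–WEIL hypothesis: `Sel₀(K_∞, E[p^∞]) = 0` for anchors of
# rank ONE (route `KatoDescentPotSupersingular` / `KatoDescentTamePotSupersingular`, rungs K9 / K8-t′, cell
# `bsd-potss`; items stmt-BirchSwinnertonDyer-19386 / 19413; a `--supports … --as helper` file; seat
# `bsd-potss-conjA-anchor` g3 (census seat; courtesy landing by a prover seat); ROUTE-FREE; nothing booked,
# BSD is not proved by any of this)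

WHY. k9-c4 g6's fine control theorem (`fineSelmerInfty_eq_bot_of_natCard_selmerGroupPInfty_eq_one[_of_local]`,
p479853: Greenberg's Prop. 3.8 for the FINE Selmer group) assumes `#Sel_{p^∞}(E/K) = 1`, i.e. a RANK-ZERO
anchor with `Ш[p^∞] = 0`. Its proof shows more: a `Γ`-fixed fine class over `K_∞` is `h_0(y)` for a class
`y ∈ Sel_{p^∞}(E/K)` which is moreover LOCALLY TRIVIAL at every place of `S` carrying the torsion socket —
in particular at every `v ∣ p`. Hence the global input can be weakened to the FINE MORDELL–WEIL hypothesis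

  (FMW) every `y ∈ Sel_{p^∞}(E/K)` that vanishes on `D_v` for all `v ∈ S`, `v ∣ p`, is zero,

which holds for rank-`0` anchors with `Ш[p^∞] = 0` (g6's case) AND for rank-ONE anchors with `Ш[p^∞] = 0`
whose generator is not `p`-divisible in `E(K_v)/torsion` for `v ∣ p` (Kummer theory: `Sel_{p^∞}(E/K) =
E(K) ⊗ ℚ_p/ℤ_p` and `ker(E(K) ⊗ ℚ_p/ℤ_p → E(K_v) ⊗ ℚ_p/ℤ_p) = 0`; this discharge is NOT in this file — it is
the one remaining Lean step named in the census memo of conjA-anchor g3, §4). The congruence-anchor census of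
this seat (`RANK1-ANCHORS-conjA-anchor-g3.tsv`) finds 75 rows of the two Conj-A cruxes (61 of them ♯) whose only
BSD-known congruent partners (conductor `< 5000`, or CM) have rank one, `p ∤ Ш_an`, pass the local `p`-torsion
tests, and carry a generator certified `p`-indivisible in `E′(ℚ_p)` — the reach of this road.

* `fineSelmerInfty_eq_bot_of_fineMordellWeil_of_local` — (FMW) + the local sockets of g6 ((T) torsion at any
  `v ∈ S`, mandatory at `v ∣ p`; or (C) the classical level-`0` tower kernel at `v ∤ p`) ⟹ `Sel₀(K_∞) = 0`,
  for EVERY number field `K`, prime `p`, `ℤ_p`-extension `κ`; `…_of_fineMordellWeil` (torsion sockets only);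
  `conjA_of_fineMordellWeil[_of_local]` — (A) at `(W, p)` in the tree's `∃`-form.
* `fineMordellWeil_of_natCard_selmerGroupPInfty_eq_one` — g6's hypothesis implies (FMW) (so this file
  generalises p479853's control theorem, which is the special case (FMW) ⟸ `#Sel_{p^∞}(E/K) = 1`, `fineMordellWeil_of_natCard_selmerGroupPInfty_eq_one`).

Proof = g6's proof verbatim up to the membership `y ∈ Sel_{p^∞}(E/K_0)`, plus the local triviality of `y` on
`D_v` for `v ∈ S` above `p` (§4 `resOfLe_layerZero_inf_eq_zero` applied to the descended strict condition),
then (FMW) in place of `#Sel = 1`. HONEST FRAMING: unconditional kernel plumbing (no named fact, no definition);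
the rank-one anchors it is meant for still need the Kummer-theoretic discharge of (FMW) (not here) and, per row,
the data of record (congruence, `Ш`, generator certificate); items 19386/19413 are NOT closed; class-wide the
cruxes are Coates–Sujatha (A), a named open problem. References: [GreenbergLNM1716] Prop. 3.8 (pp. 95–96), §3
Lemmas 3.2–3.3 (pp. 86–88); [CoatesSujatha2005] §3; [SerreGaloisCohomology1997] I.§2.6.
-/

set_option autoImplicit false
-- sibling precedent (`KatoDescentPotSupersingularAssembly.lean`): the directory name repeats the summit name
set_option linter.dupNamespace false

noncomputable section

open scoped Classical

universe u

namespace Summit.BirchSwinnertonDyer.BirchSwinnertonDyer.Theorems.FineSelmerControl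

open NumberField IsDedekindDomain Field
open Literature.NumberTheory.EllipticCurves Literature.NumberTheory.EllipticCurves.GreenbergSelmer
  Literature.NumberTheory.EllipticCurves.ZpExtension
  Literature.NumberTheory.GaloisRepresentations
  Summit.BirchSwinnertonDyer.BirchSwinnertonDyer.Theorems
  Summit.BirchSwinnertonDyer.BirchSwinnertonDyer.Theorems.FineSelmerLeSignedSelmer

section Control

variable {K : Type u} [Field K] [NumberField K] (W : WeierstrassCurve K) {p : ℕ} [Fact p.Prime]
  (κ : ZpExtension K p)

/-- **The FINE MORDELL–WEIL hypothesis (FMW) at `(W, p, S)`**, spelled inline (no definition): every class of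
`Sel_{p^∞}(E/K)` — realised on the layer `K_0 = K` of `κ` — whose restriction to `Gal(K̄/K_0) ⊓ D_v` vanishes for
every `v ∈ S` above `p` is zero. For `E(K)` finite it says `Sel_{p^∞}(E/K) = 0`; for rank one it says
`Ш(E/K)[p^∞] = 0` and the generator is `p`-indivisible in `E(K_v)/tors` at `v ∣ p` (Kummer theory, not here).
**The fine control theorem under (FMW), both local sockets**: with `S ⊇ {v ∣ p} ∪ {bad}` finite, (FMW), and at
every `v ∈ S` the torsion socket (T) or — at `v ∤ p` — the classical socket (C) of p479853, `Sel₀(K_∞, E[p^∞]) = 0`.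
[cite: GreenbergLNM1716, Prop. 3.8 (pp. 95–96) and §3 Lemmas 3.2–3.3 (pp. 86–88)] [cite: CoatesSujatha2005, §3 (Conjecture A)] -/
theorem fineSelmerInfty_eq_bot_of_fineMordellWeil_of_local [W.IsElliptic]
    (S : Finset (HeightOneSpectrum (𝓞 K)))
    (hS : ∀ v ∉ S, ((p : ℕ) : 𝓞 K) ∉ v.asIdeal ∧ W.HasGoodReductionAt v)
    (hFMW : ∀ y : W.subgroupH1 p (κ.layerSubgroup 0), y ∈ W.selmerLayer κ 0 →
      (∀ v ∈ S, ((p : ℕ) : 𝓞 K) ∈ v.asIdeal →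
        W.resOfLe p (inf_le_left : κ.layerSubgroup 0 ⊓ decomp v ≤ κ.layerSubgroup 0) y = 0) → y = 0)
    (hloc : ∀ v ∈ S,
      (∀ x : W.geomPrimaryTorsion p, p • x = 0 → (∀ d ∈ decomp v, d • x = x) → x = 0) ∨
        (((p : ℕ) : 𝓞 K) ∉ v.asIdeal ∧ W.localTowerKerPrimary κ (v.adicCompletion K) 0 = ⊥)) :
    W.fineSelmerInfty κ = ⊥ := by
  obtain ⟨γ, hγ⟩ := κ.surjective (Multiplicative.ofAdd 1)
  have hγ' : κ.IsTopGenerator γ := hγ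
  refine fineSelmerInfty_eq_bot_of_forall_conjH1_eq W κ hγ' fun c hc hfix ↦ ?_
  -- `c = h_0(y)` (Lemma 3.2 at `n = 0`)
  have hfix' : W.conjH1 p κ.kerSubgroup (γ ^ p ^ 0) c = c := by rwa [pow_zero, pow_one]
  obtain ⟨y, rfl⟩ := ZpExtension.mem_range_resOfLe_of_conjH1_eq κ hγ' 0
    (W.continuous_smul_geomPrimaryTorsion p) (exists_pow_smul_geomPrimaryTorsion_eq_zero W) c hfix'
  change W.layerToInfty κ 0 y ∈ W.fineSelmerInfty κ at hc
  change W.layerToInfty κ 0 y = 0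
  -- `conj_σ y = y` on `H¹(K_0, ·) = H¹(K, ·)`
  have hconj : ∀ σ : absoluteGaloisGroup K, W.conjH1 p (κ.layerSubgroup 0) σ y = y := fun σ ↦ by
    rw [W.conjH1_of_mem_holds p (κ.layerSubgroup 0)
      (show σ ∈ κ.layerSubgroup 0 by rw [ZpExtension.layerSubgroup_zero]; exact Subgroup.mem_top σ),
      AddMonoidHom.id_apply]
  have hsel : W.layerToInfty κ 0 y ∈ W.selmerInfty κ := FineSelmerLeSelmer.fineSelmerInfty_le_selmerInfty W κ hc
  have hyA : y ∈ W.selmerInftyPreimage κ 0 := (W.mem_selmerInftyPreimage_iff κ 0 y).2 hsel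
  -- local triviality of `y` on `D_v` at every `v ∈ S` with the torsion socket (§4)
  have htriv : ∀ v ∈ S, (∀ x : W.geomPrimaryTorsion p, p • x = 0 → (∀ d ∈ decomp v, d • x = x) → x = 0) →
      W.resOfLe p (inf_le_left : κ.layerSubgroup 0 ⊓ decomp v ≤ κ.layerSubgroup 0) y = 0 := fun v _ hT ↦ by
    obtain ⟨m₀, hm₀⟩ := exists_forall_resOfLe_inf_decomp_eq_zero W κ v 0
      (resOfLe_ker_inf_decomp_eq_zero_of_mem_fineSelmerInfty W κ hc v)
    exact resOfLe_layerZero_inf_eq_zero W κ (decomp v) m₀ hT (hm₀ m₀ (Nat.zero_le _) le_rfl)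
  -- the classical local condition at `v` from the vanishing of the level-`0` local tower kernel
  have hclass : ∀ v : HeightOneSpectrum (𝓞 K), W.localTowerKerPrimary κ (v.adicCompletion K) 0 = ⊥ →
      W.localResOver p (κ.layerSubgroup 0) (v.adicCompletion K) y = 0 := fun v hv ↦ by
    have hK := W.localResOver_conjH1_mem_localTowerKer_of_mem κ hyA v 1
    rw [hconj 1] at hK
    obtain ⟨k, hk⟩ := W.exists_pow_smul_subgroupH1_layer_eq_zero κ 0 y
    have hprim : W.localResOver p (κ.layerSubgroup 0) (v.adicCompletion K) y ∈
        W.localTowerKerPrimary κ (v.adicCompletion K) 0 :=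
      (W.mem_localTowerKerPrimary_iff κ _ 0 _).2 ⟨hK, k, by rw [← map_nsmul, hk, map_zero]⟩
    rw [hv, AddSubgroup.mem_bot] at hprim
    exact hprim
  -- `y ∈ Sel_{p^∞}(E/K_0)`
  have hmem : y ∈ W.selmerLayer κ 0 := by
    change y ∈ W.selmerGroupOver p (κ.layerSubgroup 0)
    rw [WeierstrassCurve.mem_selmerGroupOver_iff]
    refine ⟨fun v σ ↦ ?_, fun w σ ↦ ?_⟩
    · rw [hconj σ]
      by_cases hv : v ∈ S
      · rcases hloc v hv with hT | ⟨-, hC⟩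
        · exact FineSelmerLeSelmer.localKerOver_of_mem_awayKer W p (κ.layerSubgroup 0) v (htriv v hv hT)
        · exact (WeierstrassCurve.mem_localKerOver_iff _ _ _ _ _).2 (hclass v hC)
      · exact (WeierstrassCurve.mem_localKerOver_iff _ _ _ _ _).2 (hclass v
          (Greenberg1999.localTowerKerPrimary_eq_bot_of_hasGoodReductionAt W κ (hS v hv).1 (hS v hv).2 0))
    · rw [hconj σ, WeierstrassCurve.mem_localKerOver_iff]
      have hK := W.localResOver_conjH1_mem_localTowerKer_of_mem_infinitePlace κ hyA w σ
      rw [hconj σ, W.localTowerKer_eq_bot_of_forall_mem κ w.Completion 0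
        (ZpExtension.resGal_infinitePlace_mem_kerSubgroup κ w), AddSubgroup.mem_bot] at hK
      exact hK
  -- (FMW): `y` vanishes on `D_v` for every `v ∈ S` above `p` (torsion socket forced there), hence `y = 0`
  have hy0 : y = 0 := hFMW y hmem fun v hv hvp ↦ by
    rcases hloc v hv with hT | ⟨hnot, -⟩
    · exact htriv v hv hT
    · exact absurd hvp hnot
  rw [hy0, map_zero]

/-- **The fine control theorem under (FMW), torsion sockets everywhere.**
[cite: GreenbergLNM1716, Prop. 3.8 (pp. 95–96) and §3 Lemmas 3.2–3.3 (pp. 86–88)] [cite: CoatesSujatha2005, §3 (Conjecture A)] -/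
theorem fineSelmerInfty_eq_bot_of_fineMordellWeil [W.IsElliptic]
    (S : Finset (HeightOneSpectrum (𝓞 K)))
    (hS : ∀ v ∉ S, ((p : ℕ) : 𝓞 K) ∉ v.asIdeal ∧ W.HasGoodReductionAt v)
    (hFMW : ∀ y : W.subgroupH1 p (κ.layerSubgroup 0), y ∈ W.selmerLayer κ 0 →
      (∀ v ∈ S, ((p : ℕ) : 𝓞 K) ∈ v.asIdeal →
        W.resOfLe p (inf_le_left : κ.layerSubgroup 0 ⊓ decomp v ≤ κ.layerSubgroup 0) y = 0) → y = 0)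
    (hloc : ∀ v ∈ S, ∀ x : W.geomPrimaryTorsion p, p • x = 0 → (∀ d ∈ decomp v, d • x = x) → x = 0) :
    W.fineSelmerInfty κ = ⊥ :=
  fineSelmerInfty_eq_bot_of_fineMordellWeil_of_local W κ S hS hFMW fun v hv ↦ Or.inl (hloc v hv)

/-- **g6's hypothesis `#Sel_{p^∞}(E/K) = 1` implies (FMW)** (the Selmer group on the layer `K_0 = K` has the same
cardinality, `natCard_selmerLayer_zero_eq`, so it is trivial). [cite: GreenbergLNM1716, Prop. 3.8 (pp. 95–96)] -/
theorem fineMordellWeil_of_natCard_selmerGroupPInfty_eq_one [W.IsElliptic]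
    (S : Finset (HeightOneSpectrum (𝓞 K))) (h0 : Nat.card (W.selmerGroupPInfty p) = 1) :
    ∀ y : W.subgroupH1 p (κ.layerSubgroup 0), y ∈ W.selmerLayer κ 0 →
      (∀ v ∈ S, ((p : ℕ) : 𝓞 K) ∈ v.asIdeal →
        W.resOfLe p (inf_le_left : κ.layerSubgroup 0 ⊓ decomp v ≤ κ.layerSubgroup 0) y = 0) → y = 0 := by
  intro y hmem _
  have hcard : Nat.card (W.selmerLayer κ 0) = 1 := by rw [W.natCard_selmerLayer_zero_eq κ, h0]
  haveI : Subsingleton (W.selmerLayer κ 0) := (Nat.card_eq_one_iff_unique.1 hcard).1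
  have hy0 : (⟨y, hmem⟩ : W.selmerLayer κ 0) = ⟨0, (W.selmerLayer κ 0).zero_mem⟩ := Subsingleton.elim _ _
  rw [Subtype.ext_iff] at hy0
  exact hy0

-- (p479853's control theorem `fineSelmerInfty_eq_bot_of_natCard_selmerGroupPInfty_eq_one_of_local` is the special case
-- `fineMordellWeil_of_natCard_selmerGroupPInfty_eq_one` ∘ `fineSelmerInfty_eq_bot_of_fineMordellWeil_of_local`; its verbatim re-derivation
-- `…_of_local'` of the author's draft is omitted here: the gate refuses identical restatements of landed declarations, `dedup.landed`.)

/-- **(A) at `(W, p)` under (FMW)** (the tree's `∃`-form, every `ℤ_p`-extension): the Pontryagin dual of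
`Sel₀(K_∞, E[p^∞])` is finitely generated over `ℤ_p` — indeed zero. [cite: CoatesSujatha2005, §3 (Conjecture A)]
[cite: GreenbergLNM1716, Prop. 3.8 (pp. 95–96)] -/
theorem conjA_of_fineMordellWeil_of_local [W.IsElliptic]
    (S : Finset (HeightOneSpectrum (𝓞 K)))
    (hS : ∀ v ∉ S, ((p : ℕ) : 𝓞 K) ∉ v.asIdeal ∧ W.HasGoodReductionAt v)
    (hFMW : ∀ y : W.subgroupH1 p (κ.layerSubgroup 0), y ∈ W.selmerLayer κ 0 →
      (∀ v ∈ S, ((p : ℕ) : 𝓞 K) ∈ v.asIdeal →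
        W.resOfLe p (inf_le_left : κ.layerSubgroup 0 ⊓ decomp v ≤ κ.layerSubgroup 0) y = 0) → y = 0)
    (hloc : ∀ v ∈ S,
      (∀ x : W.geomPrimaryTorsion p, p • x = 0 → (∀ d ∈ decomp v, d • x = x) → x = 0) ∨
        (((p : ℕ) : 𝓞 K) ∉ v.asIdeal ∧ W.localTowerKerPrimary κ (v.adicCompletion K) 0 = ⊥)) :
    ∃ (γ : absoluteGaloisGroup K) (D : W.FineSelmerDualData κ γ),
      Module.Finite ℤ_[p] (RestrictScalars ℤ_[p] (IwasawaAlgebra p) D.X) := by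
  obtain ⟨γ, hγ⟩ : ∃ γ : absoluteGaloisGroup K, κ.IsTopGenerator γ := κ.surjective (Multiplicative.ofAdd 1)
  exact conjA_of_finite_fineSelmerInfty_pTorsion W κ hγ
    (finite_fineSelmerInfty_pTorsion_of_eq_bot W κ
      (fineSelmerInfty_eq_bot_of_fineMordellWeil_of_local W κ S hS hFMW hloc))

/-- **(A) at `(W, p)` under (FMW)**, torsion sockets everywhere. [cite: CoatesSujatha2005, §3 (Conjecture A)]
[cite: GreenbergLNM1716, Prop. 3.8 (pp. 95–96)] -/
theorem conjA_of_fineMordellWeil [W.IsElliptic]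
    (S : Finset (HeightOneSpectrum (𝓞 K)))
    (hS : ∀ v ∉ S, ((p : ℕ) : 𝓞 K) ∉ v.asIdeal ∧ W.HasGoodReductionAt v)
    (hFMW : ∀ y : W.subgroupH1 p (κ.layerSubgroup 0), y ∈ W.selmerLayer κ 0 →
      (∀ v ∈ S, ((p : ℕ) : 𝓞 K) ∈ v.asIdeal →
        W.resOfLe p (inf_le_left : κ.layerSubgroup 0 ⊓ decomp v ≤ κ.layerSubgroup 0) y = 0) → y = 0)
    (hloc : ∀ v ∈ S, ∀ x : W.geomPrimaryTorsion p, p • x = 0 → (∀ d ∈ decomp v, d • x = x) → x = 0) :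
    ∃ (γ : absoluteGaloisGroup K) (D : W.FineSelmerDualData κ γ),
      Module.Finite ℤ_[p] (RestrictScalars ℤ_[p] (IwasawaAlgebra p) D.X) :=
  conjA_of_fineMordellWeil_of_local W κ S hS hFMW fun v hv ↦ Or.inl (hloc v hv)

end Control

end Summit.BirchSwinnertonDyer.BirchSwinnertonDyer.Theorems.FineSelmerControl

end
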